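import Summits.QuantumFields.YangMills.Theorems.BalabanUVNodesN20KeyedRelWeightDialMonotone
import Summits.QuantumFields.YangMills.Theorems.BalabanUVNodesN20TwoRunKeyedPersistentWeight

/-!
# BalabanUVNodes ∕ N20 (NE7b) — THE PERSISTENT-ACTIVITY FRACTION OF RECORD STRATIFIED BY BIRTH LEVEL: the persistence class of record under any cut policy
# `jcut` is the DISJOINT UNION over the levels `1 ≤ j ≤ jcut K` of the keys whose FIRST large-field level is `j`; the canonical fraction `W` of the reading of
# record is at most the SUM of the per-birth-level fractions; NE7b AT THE RECORD from a PER-BIRTH-LEVEL SURVIVAL RATE `V·r^{age}` (the renewal currency of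
# `T4WeightBudget` §2–§3 ∕ dag-n20-d's `…N20RenewalCurrency` read AT THE KEYED READING `crOfRecord₁₃VAt K₀ jcut sh`)

Cell `pub-ymgap` (HUMAN RULING D-0062 Track A; work-bound push D-0149, director-ym №197), width seat `pub-ymgap-dag-n20-w2` (gen 3, harness re-seat of gen 0 ∕ gen 2)
on node N20 = NE7b; CLAIM-1 of the re-seat, inside this seat's own lineage (the persistence class ∕ canonical fraction of record: gen 0 `…N20TwoRunKeyedPersistentWeight`
… `…N20KeyedRelWeightCutZero`, gen 2 `…N20KeyedRelWeightOverCut` … `…N20KeyedRelWeightDialMonotone`).  Filed `--kind proof --supports stmt-QuantumFields-20544 --as helper`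
(K3⁷ `SpineGivenEndpointR13SepCoPH`, skeleton v5 941dddb108cbaacf — the `KeyedRelWeight` text is v4's verbatim); COUNT-NEUTRAL; LOCATED.
[III] = [Balaban1988Convergent], [LF-I] = [Balaban1989LargeFieldI], [LF-II] = [Balaban1989LargeFieldII].

WHY.  Gen 2 read the N20 conjunct of `stub_expansion13H` at the pinned reading as «the persistent-activity fraction of record `W K ∈ [0,1]` under the cut reading `jc` is `< 1`
at every step and summable» (`…Canonical.relWeightBound_crOfRecord₁₃VAt_iff`), with `W K` = the worst-source fraction of the two dressed partition functions carried by the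
persistence class `badClass₁₃ θ K₀ g₀ jcut K t` = the keys with an OLD large-field region at SOME level `1 ≤ j ≤ jcut K` (`Node00/TwoRunSitePersistence`).  Print's
inductive statement is keyed FINER: [LF-II] p.384 «If Z is a component of Z_j, and j(Z) is the index of a first large field region contained in Z, then we write the factor
connected with Z in the form exp(−κ_j(Z) − 2p₀(g_{j(Z)}))», (1.80) «the factor exp(−κ_j(Z)) controls K renormalization steps» — a region BORN at level `j` pays per SURVIVED
step.  The tree's renewal arithmetic for exactly that shape exists at ABSTRACT carriers (`T4WeightBudget.relWeight_le_sum_of_cover` «the union bound over birth position ∕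
birth scale», `sum_range_pow_sub_le`, `summable_weightMajorant`; dag-n20-d's `…N20RenewalCurrency` p453415 at `SRec`-generic spine carriers; `T4PersistenceRenewal.FibreRate`)
but NOT at the keyed reading of record that K3⁷ v5 pins (`rg -l FibreRate | xargs rg -l crOfRecord₁₃` = ∅, 2026-08-28); dag-n20-w1's sockets `…N20KeyedRelWeightSocket(AtRecord13CoPH(V))`
are CUMULATIVE (one term bound per `K` for the whole class below the cut).  This file puts the BIRTH LEVEL on the keys of record:
* §1 (generic, folklore) a monotone chain of finite classes `S 0 = ∅ ⊆ S 1 ⊆ …` is the disjoint union of its STRATA `S (j+1) ∖ S j`: `disjoint_strata`, `eq_biUnion_range_strata`,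
  ★ `sum_eq_sum_range_strata` (exact telescoping `Σ_{S n} f = Σ_{j<n} Σ_{S (j+1) ∖ S j} f`); `sum_range_pow_age_le` (the age sum `Σ_{j<n} r^{M−(j+1)} ≤ r^{M−n}∕(1−r)` for `n ≤ M`,
  `T4WeightBudget.sum_range_pow_sub_le` re-indexed); `summable_ageMajorant_of_linearAge` (`c·K ≤ K₀+K−jcut K ⇒ Σ_K V·r^{K₀+K−jcut K} < ∞`, `T4WeightBudget.summable_weightMajorant`'s
  argument at the offset `K₀`);
* §2 (the keys of record, every `θ K₀ g₀`) the LEVEL CHAIN `n ↦ badClass₁₃ θ K₀ g₀ (fun _ ↦ n) K t` is monotone from `∅` and the policy class at step `K` is its `jcut K`-th member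
  (`badClass₁₃_eq_level_at`, dag-n20-w1's `badClass₁₃_mono_at ∕ _congr_at ∕ _eq_empty_of_apply_eq_zero` BY NAME); ★ `mem_stratum_iff` (a key lies in the stratum `j` iff it is a
  class key whose FIRST large-field level is EXACTLY `j+1` — print's `j(Z)` read on whole histories); `keyA₁₃_mem_stratum_iff` (run A, the (2.1)-antitone chain: `s.Λ_{j+1} ≠ T_η`
  and `s.Λ_j = T_η`, gen 0's `keyOldLargeField_twoRunKeyA_iff_last`); ★★ `sum_badClass₁₃_eq_sum_strata` (THE BIRTH-LEVEL STRATIFICATION of the persistence class of record under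
  ANY policy: `Σ_{badClass₁₃ jcut K t} f = Σ_{j < jcut K} Σ_{stratum j} f`, exact) · `badClass₁₃_eq_biUnion_strata` · `disjoint_badClass₁₃_strata`;
* §3 (the reading of record `crOfRecord₁₃VAt K₀ jcut sh`, every Stage-13 tuple with core provisos, HYPOTHESIS = per-stratum relative bounds) ★★ `W_crOfRecord₁₃VAt_le_sum_levels`
  (`Σ_{stratum j} weightA₁₃ K t ≤ a j K · Σ_{classSet} weightA₁₃ K t` and the run-B twin with `b j K`, `|t| ≤ 1`, `j < jcut K` ⇒ `W K ≤ Σ_{j<jcut K} max (a j K) (b j K)`: the sum of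
  the per-birth-level fractions is ADMISSIBLE for the whole class, by §2's exact stratification — no union bound lost) · ★★ `relWeightBound_crOfRecord₁₃VAt_of_levelFractions`
  (+ those sums `< 1` and summable over `K` ⇒ `RelWeightBound` AT the reading with its canonical `W`, gen 2's `relWeightBound_crOfRecord₁₃VAt_iff`);
* §4 (print's survival shape) ★★ `W_crOfRecord₁₃VAt_le_survival` (per-stratum SURVIVAL domination `Σ_{stratum j} weight ≤ V·r^{K₀+K−(j+1)}·Σ_{classSet} weight` in both runs —
  «a pending region first created at level `j+1` of the `K₀+K`-level run costs `r` per survived level» — and the cut inside the window `jcut K ≤ K₀+K` ⇒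
  `W K ≤ V·r^{K₀+K−jcut K}∕(1−r)`: geometric in the AGE FLOOR `K₀+K−jcut K` of the policy) · ★★ `relWeightBound_crOfRecord₁₃VAt_of_survival` (+ `V·r^{age floor}∕(1−r) < 1` at
  every step and `Σ_K V·r^{age floor} < ∞` ⇒ the N20 face AT the reading) · `relWeightBound_crOfRecord₁₃VAt_of_survival_linearAge` (summability from a LINEAR age floor
  `c·K ≤ K₀+K−jcut K`, e.g. print's window `jcut K = K₀+K−j⋆(K)` with `j⋆(K) ≥ c·K`) · ★★ `keyedRelWeight_shape_crOfRecord₁₃V_of_survival` (the K3⁷ v5 `KeyedRelWeight` binder shape at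
  the per-tuple-cut V reading `crOfRecord₁₃VAt 0 (jc F θ hP g₀ os) sh`, `N = 2`, from per-tuple survival data).
WHAT IT SAYS FOR THE STUB (located, count-neutral): on the N20 face the cut dial `jc` is read through ONE number per step, the AGE FLOOR `K₀+K−jc(…) K`; given a per-birth-level
survival rate `r < 1` with entropy letter `V` at the keyed classes of record, NE7b at the record holds for EVERY cut reading whose age floor grows linearly and starts above
`log_{1∕r}(V∕(1−r))` — the interior of gen 2's dial index (`N20-W2-DIAL-INDEX.md`) priced in the renewal currency.  The survival domination is WHERE NE7b's content now sits.
Cited BY NAME, not re-typed: dag-n20-d `…SpineCanonicalWeights` (`admW`, `wInf`, `wInf_nonneg`, `wInf_le_of_mem`), `…SpineReadingOfRecord13CoPH(V)` (`classSet₁₃`, `weightA∕B₁₃`,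
`badClass₁₃`, `keyA₁₃`, `crOfRecord₁₃VAt`), `Node00/TwoRunSitePersistence` (`KeyOldLargeField`, `keyOldLargeField_succ_iff`, `not_keyOldLargeField_iff`), dag-n20-w1
`…N20KeyedRelWeightPolicyWall` (`mem_badClass₁₃_iff`, `badClass₁₃_mono_at`, `badClass₁₃_congr_at`, `badClass₁₃_eq_empty_of_apply_eq_zero`), `…N20KeyedRelWeightSocketAtRecord13CoPH`
(`keyA₁₃_mem_classSet₁₃`), gen 0 `…N21KeyedShellWeightShellZero` (`weightA₁₃_nonneg`, `weightB₁₃_nonneg`), `…N20TwoRunKeyedPersistentWeight` (`keyOldLargeField_twoRunKeyA_iff_last`),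
gen 2 `…N20KeyedRelWeightCanonical` (`relWeightBound_crOfRecord₁₃VAt_iff`), `T4WeightBudget` (`RelWeightBound`, `sum_range_pow_sub_le`).

HONEST FRAMING.  [folklore] finite-sum ∕ real-analysis bookkeeping; NO weight bounded, NO estimate proved.  The per-stratum survival domination of §4 (and the per-level fractions
of §3) are HYPOTHESES — NE7b's body in the renewal currency, NAMED OPEN, inhabited for no Bałaban family today (A6: LOCATED; nothing here discharges it).  Nothing of Bałaban's is
asserted: [LF-II] (1.80) ∕ (1.89) print ABSOLUTE size bounds on the large-field factors of ONE run (`T′_k(X)1 ≤ exp(−2(1+β₀)^{−1}p₀(g_k))`); the RELATIVE extraction, the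
entropy letter `V` and the survival-window bound are the cell's NE7b — NOT PRINTED for `d = 4`, NOT proved; (α)-instance 0∕1; no `Provisos₁₃CoPH` inhabitant claimed (K0⁷ OPEN);
N19 ∕ N20 ∕ N21 ∕ N27 NOT discharged; K3⁷ NOT closed; counts unmoved (typed 28∕28 · discharged 5∕27); no count claim (the chair's single count line is the only count).  One finite
`𝕋⁴_{L^K}` programme at fixed `ε = L^{−K}`, Bałaban AS PRINTED; the YM mass gap (Clay) is NOT proved by any of this — R4 closes the conditional finite-𝕋⁴ rung `BalabanLadder.UV`
only; NOT ℝ⁴, NOT infinite volume, NOT OS.  No `def`, no `instance`, no `notation`, no `sorry`.  Sources (locators, bookkeeping only): [LF-II] (1.80) p.384, (1.85)–(1.89)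
pp.386–387; [LF-I] p.177 (i)–(ii); [III] (2.1) p.254, (2.18) p.257; [King1986] (3.10)–(3.11) p.656.
-/

noncomputable section

open scoped BigOperators

namespace Summit.QuantumFields.YangMills.BalabanUVNodes.N20KeyedRelWeightLevels

open Literature.MathematicalPhysics.QuantumFieldTheory.Balaban1983to89 Literature.MathematicalPhysics.QuantumFieldTheory.Balaban1983to89.Node00
open T4Continuum
open T4WeightBudget (RelWeightBound)
open YMDAG.UVSplit hiding SU
open Summit.QuantumFields.YangMills.BalabanUVNodes.SpineCanonicalWeights
open Summit.QuantumFields.YangMills.BalabanUVNodes.N21KeyedShellWeightShellZero (weightA₁₃_nonneg weightB₁₃_nonneg)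
open Summit.QuantumFields.YangMills.BalabanUVNodes.N20KeyedRelWeightPolicyWall (mem_badClass₁₃_iff badClass₁₃_mono_at badClass₁₃_congr_at badClass₁₃_eq_empty_of_apply_eq_zero)
open Summit.QuantumFields.YangMills.BalabanUVNodes.N20KeyedRelWeightSocketAtRecord13CoPH (keyA₁₃_mem_classSet₁₃)
open Summit.QuantumFields.YangMills.BalabanUVNodes.N20TwoRunKeyedPersistentWeight (keyOldLargeField_twoRunKeyA_iff_last)
open Summit.QuantumFields.YangMills.BalabanUVNodes.N20KeyedRelWeightCanonical (relWeightBound_crOfRecord₁₃VAt_iff)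

/-! ## §1  Folklore: the strata of a monotone chain of finite classes; the age sum; summability from a linear age floor -/

section Chain

variable {ι : Type*} [DecidableEq ι] {S : ℕ → Finset ι}

/-- **THE STRATA OF A MONOTONE CHAIN ARE PAIRWISE DISJOINT**: `S (i+1) ∖ S i` and `S (j+1) ∖ S j` are disjoint for `i ≠ j` when `S` is monotone.
[cite: Balaban1989LargeFieldII, (1.80) p.384 (bookkeeping)] -/
theorem disjoint_strata (hmono : Monotone S) {i j : ℕ} (hij : i ≠ j) : Disjoint (S (i + 1) \ S i) (S (j + 1) \ S j) := by
  wlog h : i < j generalizing i j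
  · exact (this hij.symm (lt_of_le_of_ne (not_lt.1 h) hij.symm)).symm
  rw [Finset.disjoint_left]
  intro x hx hx'
  exact (Finset.mem_sdiff.1 hx').2 (hmono (Nat.succ_le_of_lt h) (Finset.mem_sdiff.1 hx).1)

/-- **A MONOTONE CHAIN FROM `∅` IS THE UNION OF ITS STRATA**: `S n = ⋃_{j<n} (S (j+1) ∖ S j)` when `S 0 = ∅` and `S` is monotone.
[cite: Balaban1989LargeFieldII, (1.80) p.384 (bookkeeping)] -/
theorem eq_biUnion_range_strata (h0 : S 0 = ∅) (hmono : Monotone S) (n : ℕ) :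
    S n = (Finset.range n).biUnion fun j => S (j + 1) \ S j := by
  induction n with
  | zero => simp [h0]
  | succ n ih =>
    rw [Finset.range_add_one, Finset.biUnion_insert, ← ih]
    ext x
    simp only [Finset.mem_union, Finset.mem_sdiff]
    constructor
    · intro hx
      by_cases h : x ∈ S n
      · exact Or.inr h
      · exact Or.inl ⟨hx, h⟩
    · rintro (⟨hx, -⟩ | hx)
      · exact hx
      · exact hmono n.le_succ hx

/-- **★ EXACT TELESCOPING OVER THE STRATA**: `Σ_{x ∈ S n} f x = Σ_{j<n} Σ_{x ∈ S (j+1) ∖ S j} f x` for a monotone chain with `S 0 = ∅` — the birth-level resummation of a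
class sum, with no union bound lost. [cite: Balaban1989LargeFieldII, (1.80) p.384, (1.85) p.386 (bookkeeping)] -/
theorem sum_eq_sum_range_strata (h0 : S 0 = ∅) (hmono : Monotone S) (f : ι → ℝ) (n : ℕ) :
    ∑ x ∈ S n, f x = ∑ j ∈ Finset.range n, ∑ x ∈ S (j + 1) \ S j, f x := by
  induction n with
  | zero => simp [h0]
  | succ n ih => rw [Finset.sum_range_succ, ← ih, Finset.sum_sdiff_eq_sub (hmono n.le_succ)]; ring

end Chain

section Arithmetic

/-- **THE AGE SUM**: for a run with `M` levels cut at `n ≤ M`, the survival factors of the strata sum to at most the factor of the YOUNGEST cut stratum over `1 − r`: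
`Σ_{j<n} r^{M−(j+1)} ≤ r^{M−n}∕(1−r)` (reflect to `r^{M−n}·Σ_{i<n} r^i` and bound the geometric sum; the birth-level twin of `T4WeightBudget.sum_range_pow_sub_le`).
[cite: Balaban1989LargeFieldII, (1.80) p.384; King1986, (3.10)–(3.11) p.656 (bookkeeping)] -/
theorem sum_range_pow_age_le {r : ℝ} (h0 : 0 ≤ r) (h1 : r < 1) {n M : ℕ} (hn : n ≤ M) :
    ∑ j ∈ Finset.range n, r ^ (M - (j + 1)) ≤ r ^ (M - n) / (1 - r) := by
  have hgeom := summable_geometric_of_lt_one h0 h1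
  calc ∑ j ∈ Finset.range n, r ^ (M - (j + 1)) = ∑ j ∈ Finset.range n, r ^ (M - n + (n - 1 - j)) :=
        Finset.sum_congr rfl fun j hj => by rw [Finset.mem_range] at hj; rw [show M - (j + 1) = M - n + (n - 1 - j) by omega]
    _ = ∑ j ∈ Finset.range n, r ^ (M - n + j) := Finset.sum_range_reflect (fun i => r ^ (M - n + i)) n
    _ = r ^ (M - n) * ∑ j ∈ Finset.range n, r ^ j := by rw [Finset.mul_sum]; exact Finset.sum_congr rfl fun j _ => pow_add r _ _
    _ ≤ r ^ (M - n) * ∑' j, r ^ j :=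
        mul_le_mul_of_nonneg_left (hgeom.sum_le_tsum _ fun j _ => pow_nonneg h0 j) (pow_nonneg h0 _)
    _ = r ^ (M - n) / (1 - r) := by rw [tsum_geometric_of_lt_one h0 h1, div_eq_mul_inv]

/-- **SUMMABILITY OVER THE NUMBER OF STEPS FROM A LINEAR AGE FLOOR**: if the policy leaves an age floor `K₀ + K − jcut K ≥ c·K` (`c > 0`), `0 < r < 1`, `0 ≤ V`, then
`K ↦ V·r^{K₀+K−jcut K}` is summable (`T4WeightBudget.summable_weightMajorant`'s argument, at the offset `K₀`).
[cite: Balaban1989LargeFieldII, (1.80) p.384; King1986, (3.10)–(3.11) p.656 (bookkeeping)] -/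
theorem summable_ageMajorant_of_linearAge {r V c : ℝ} (h0 : 0 < r) (h1 : r < 1) (hV : 0 ≤ V) (hc : 0 < c) {K₀ : ℕ} {jcut : ℕ → ℕ}
    (hfrac : ∀ K : ℕ, c * K ≤ ((K₀ + K - jcut K : ℕ) : ℝ)) :
    Summable (fun K => V * r ^ (K₀ + K - jcut K)) := by
  have hrc0 : 0 ≤ r ^ c := Real.rpow_nonneg h0.le c
  have hrc1 : r ^ c < 1 := Real.rpow_lt_one h0.le h1 hc
  have key : ∀ K : ℕ, r ^ (K₀ + K - jcut K) ≤ (r ^ c) ^ K := by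
    intro K
    rw [← Real.rpow_natCast r (K₀ + K - jcut K), ← Real.rpow_natCast (r ^ c) K, ← Real.rpow_mul h0.le]
    exact Real.rpow_le_rpow_of_exponent_ge h0 h1.le (hfrac K)
  exact Summable.of_nonneg_of_le (fun K => mul_nonneg hV (pow_nonneg h0.le _))
    (fun K => mul_le_mul_of_nonneg_left (key K) hV) ((summable_geometric_of_lt_one hrc0 hrc1).mul_left V)

end Arithmetic

/-! ## §2  At the keys of record: the level chain of the persistence class and its strata (the keys whose FIRST large-field level is exactly `j+1`) -/

section Keys

variable {F : T4Family} {N : ℕ} [NeZero N] (θ : Stage13HParams F N) (K₀ : ℕ) (g₀ : ℕ → ℝ)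

/-- **THE POLICY CLASS AT STEP `K` IS THE `jcut K`-TH MEMBER OF THE LEVEL CHAIN** `n ↦ badClass₁₃ θ K₀ g₀ (fun _ ↦ n) K t` (dag-n20-w1's `badClass₁₃_congr_at`).
[cite: Balaban1989LargeFieldII, (1.80) p.384 (bookkeeping)] -/
theorem badClass₁₃_eq_level_at (jcut : ℕ → ℕ) (K : ℕ) (t : ℝ) :
    badClass₁₃ θ K₀ g₀ jcut K t = badClass₁₃ θ K₀ g₀ (fun _ => jcut K) K t :=
  badClass₁₃_congr_at θ K₀ g₀ (jcut := jcut) (jcut' := fun _ => jcut K) (K := K) rfl t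

/-- **THE LEVEL CHAIN IS MONOTONE** (a deeper cut, a larger class; dag-n20-w1's `badClass₁₃_mono_at`). [cite: Balaban1989LargeFieldII, (1.80) p.384 (bookkeeping)] -/
theorem badClass₁₃_level_monotone (K : ℕ) (t : ℝ) : Monotone fun n : ℕ => badClass₁₃ θ K₀ g₀ (fun _ => n) K t :=
  fun _ _ h => badClass₁₃_mono_at θ K₀ g₀ h t

/-- **… AND STARTS FROM `∅`** (nothing is old below level `0`). [cite: Balaban1989LargeFieldII, (1.80) p.384 (bookkeeping)] -/
theorem badClass₁₃_level_zero (K : ℕ) (t : ℝ) : badClass₁₃ θ K₀ g₀ (fun _ => 0) K t = ∅ :=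
  badClass₁₃_eq_empty_of_apply_eq_zero θ K₀ g₀ rfl t

variable [DecidableEq (Σ K, SiteSeqKey F (K₀ + K))]

/-- **★ MEMBERSHIP IN THE STRATUM `j`** `badClass₁₃ … (fun _ ↦ j+1) K t ∖ badClass₁₃ … (fun _ ↦ j) K t`: a key of the class set whose FIRST large-field level is EXACTLY `j + 1`
(`Λ_{j+1} ≠ T_η` and `Λ_i = T_η` for `1 ≤ i ≤ j`) — [LF-II] p.384's «j(Z) is the index of a first large field region» read on the whole history.
[cite: Balaban1989LargeFieldII, (1.80) p.384; Balaban1988Convergent, (2.18) p.257 (bookkeeping)] -/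
theorem mem_stratum_iff (j K : ℕ) (t : ℝ) (x : Σ K, SiteSeqKey F (K₀ + K)) :
    x ∈ badClass₁₃ θ K₀ g₀ (fun _ => j + 1) K t \ badClass₁₃ θ K₀ g₀ (fun _ => j) K t ↔
      x ∈ classSet₁₃ θ K₀ g₀ K ∧ x.2.2 (j + 1) ≠ Set.univ ∧ ∀ i, 1 ≤ i → i ≤ j → x.2.2 i = Set.univ := by
  rw [Finset.mem_sdiff, mem_badClass₁₃_iff, mem_badClass₁₃_iff, keyOldLargeField_succ_iff]
  constructor
  · rintro ⟨⟨hx, h | h⟩, hn⟩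
    · exact absurd ⟨hx, h⟩ hn
    · exact ⟨hx, h, (not_keyOldLargeField_iff j _).1 fun hk => hn ⟨hx, hk⟩⟩
  · rintro ⟨hx, hne, hall⟩
    exact ⟨⟨hx, Or.inr hne⟩, fun hk => (not_keyOldLargeField_iff j _).2 hall hk.2⟩

/-- **RUN A's KEY IN THE STRATUM `j`, SINGLE-LEVEL FORM** (the (2.1)-antitone chain `Λ_1 ⊇ Λ_2 ⊇ …` of an admissible index; `j + 1 ≤ K₀ + K`): the (2.18) history `s` of run A has
its key in the stratum iff `s.Λ_{j+1} ≠ T_η` and (for `j ≥ 1`) `s.Λ_j = T_η` — a large-field region is created AT level `j + 1` and none is pending at level `j`.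
[cite: Balaban1988Convergent, (2.1) p.254, (2.18) p.257; Balaban1989LargeFieldII, (1.80) p.384 (bookkeeping)] -/
theorem keyA₁₃_mem_stratum_iff (K : ℕ) (t : ℝ) {j : ℕ} (hj : j + 1 ≤ K₀ + K)
    (s : SeqOfRecord F θ.ν θ.τ9.M (histA₁₃ θ K₀ g₀ K) (K₀ + K) (K₀ + K)) :
    keyA₁₃ θ K₀ g₀ K s ∈ badClass₁₃ θ K₀ g₀ (fun _ => j + 1) K t \ badClass₁₃ θ K₀ g₀ (fun _ => j) K t ↔
      s.Λ (j + 1) ≠ Set.univ ∧ (1 ≤ j → s.Λ j = Set.univ) := by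
  rw [Finset.mem_sdiff, mem_badClass₁₃_iff, mem_badClass₁₃_iff]
  have hT := keyA₁₃_mem_classSet₁₃ θ K₀ g₀ K s
  have hA : ∀ {n : ℕ}, 1 ≤ n → n ≤ K₀ + K → (KeyOldLargeField n (keyA₁₃ θ K₀ g₀ K s).2 ↔ s.Λ n ≠ Set.univ) := fun h1 hn =>
    keyOldLargeField_twoRunKeyA_iff_last F θ.ν θ.τ9.M (histA₁₃ θ K₀ g₀ K) (K₀ + K) (K₀ + K) h1 hn s
  rw [hA (by omega) hj]
  rcases Nat.eq_zero_or_pos j with rfl | hj1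
  · constructor
    · rintro ⟨⟨-, h⟩, -⟩
      exact ⟨h, fun h0 => absurd h0 (by omega)⟩
    · rintro ⟨h, -⟩
      exact ⟨⟨hT, h⟩, fun hk => not_keyOldLargeField_zero _ hk.2⟩
  · rw [hA hj1 (by omega)]
    constructor
    · rintro ⟨⟨-, h⟩, hn⟩
      exact ⟨h, fun _ => not_not.1 fun hne => hn ⟨hT, hne⟩⟩
    · rintro ⟨h, hall⟩
      exact ⟨⟨hT, h⟩, fun hk => hk.2 (hall hj1)⟩

/-- **★★ THE BIRTH-LEVEL STRATIFICATION OF THE PERSISTENCE CLASS OF RECORD** under ANY policy `jcut`, at every step `K` and source `t`, for every function `f` on the keys: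
`Σ_{x ∈ badClass₁₃ … jcut K t} f x = Σ_{j < jcut K} Σ_{x ∈ stratum j} f x` — EXACT (the strata are disjoint and exhaust the class).
[cite: Balaban1989LargeFieldII, (1.80) p.384, (1.85) p.386; Balaban1988Convergent, (2.18) p.257 (bookkeeping)] -/
theorem sum_badClass₁₃_eq_sum_strata (jcut : ℕ → ℕ) (K : ℕ) (t : ℝ) (f : (Σ K, SiteSeqKey F (K₀ + K)) → ℝ) :
    ∑ x ∈ badClass₁₃ θ K₀ g₀ jcut K t, f x =
      ∑ j ∈ Finset.range (jcut K), ∑ x ∈ badClass₁₃ θ K₀ g₀ (fun _ => j + 1) K t \ badClass₁₃ θ K₀ g₀ (fun _ => j) K t, f x := by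
  rw [badClass₁₃_eq_level_at θ K₀ g₀ jcut K t]
  exact sum_eq_sum_range_strata (S := fun n => badClass₁₃ θ K₀ g₀ (fun _ => n) K t) (badClass₁₃_level_zero θ K₀ g₀ K t)
    (badClass₁₃_level_monotone θ K₀ g₀ K t) f (jcut K)

/-- **THE PERSISTENCE CLASS OF RECORD IS THE UNION OF ITS STRATA.** [cite: Balaban1989LargeFieldII, (1.80) p.384; Balaban1988Convergent, (2.18) p.257 (bookkeeping)] -/
theorem badClass₁₃_eq_biUnion_strata (jcut : ℕ → ℕ) (K : ℕ) (t : ℝ) :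
    badClass₁₃ θ K₀ g₀ jcut K t =
      (Finset.range (jcut K)).biUnion fun j => badClass₁₃ θ K₀ g₀ (fun _ => j + 1) K t \ badClass₁₃ θ K₀ g₀ (fun _ => j) K t := by
  rw [badClass₁₃_eq_level_at θ K₀ g₀ jcut K t]
  exact eq_biUnion_range_strata (S := fun n => badClass₁₃ θ K₀ g₀ (fun _ => n) K t) (badClass₁₃_level_zero θ K₀ g₀ K t)
    (badClass₁₃_level_monotone θ K₀ g₀ K t) (jcut K)

/-- **… AND THE STRATA ARE PAIRWISE DISJOINT** (a key has ONE first large-field level). [cite: Balaban1989LargeFieldII, (1.80) p.384 (bookkeeping)] -/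
theorem disjoint_badClass₁₃_strata (K : ℕ) (t : ℝ) {i j : ℕ} (hij : i ≠ j) :
    Disjoint (badClass₁₃ θ K₀ g₀ (fun _ => i + 1) K t \ badClass₁₃ θ K₀ g₀ (fun _ => i) K t)
      (badClass₁₃ θ K₀ g₀ (fun _ => j + 1) K t \ badClass₁₃ θ K₀ g₀ (fun _ => j) K t) :=
  disjoint_strata (S := fun n => badClass₁₃ θ K₀ g₀ (fun _ => n) K t) (badClass₁₃_level_monotone θ K₀ g₀ K t) hij

end Keys

/-! ## §3  At the reading of record: the canonical fraction is at most the sum of the per-birth-level fractions; N20 from per-level budgets -/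

section Reading

variable {F : T4Family} {N : ℕ} [NeZero N] (θ : Stage13HParams F N) (hP : θ.Provisos₁₃CoPH F N) (K₀ : ℕ) (g₀ : ℕ → ℝ) (os : List (ULoop F))
  (jcut : ℕ → ℕ) (sh : ShellSplit₁₃CoPH N K₀) [DecidableEq (Σ K, SiteSeqKey F (K₀ + K))]

/-- **★★ THE PERSISTENT-ACTIVITY FRACTION OF RECORD IS AT MOST THE SUM OF THE PER-BIRTH-LEVEL FRACTIONS**: if at step `K`, for every source `|t| ≤ 1` and every level
`j < jcut K`, the stratum-`j` mass of run A is `≤ a j K ·` (run A's class total) and that of run B is `≤ b j K ·` (run B's class total), with `a j K ≥ 0`, then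
`(crOfRecord₁₃VAt K₀ jcut sh F θ hP g₀ os).W K ≤ Σ_{j < jcut K} max (a j K) (b j K)` — the sum is an ADMISSIBLE weight for the whole class by §2's exact stratification.
[cite: Balaban1989LargeFieldII, (1.80) p.384, (1.85)–(1.89) pp.386–387; King1986, (3.10)–(3.11) p.656 (bookkeeping)] -/
theorem W_crOfRecord₁₃VAt_le_sum_levels {a b : ℕ → ℕ → ℝ} (K : ℕ) (ha : ∀ j < jcut K, 0 ≤ a j K)
    (hA : ∀ t : ℝ, |t| ≤ 1 → ∀ j < jcut K,
      ∑ x ∈ badClass₁₃ θ K₀ g₀ (fun _ => j + 1) K t \ badClass₁₃ θ K₀ g₀ (fun _ => j) K t, weightA₁₃ θ hP K₀ g₀ os K t x ≤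
        a j K * ∑ x ∈ classSet₁₃ θ K₀ g₀ K, weightA₁₃ θ hP K₀ g₀ os K t x)
    (hB : ∀ t : ℝ, |t| ≤ 1 → ∀ j < jcut K,
      ∑ x ∈ badClass₁₃ θ K₀ g₀ (fun _ => j + 1) K t \ badClass₁₃ θ K₀ g₀ (fun _ => j) K t, weightB₁₃ θ hP K₀ g₀ os K t x ≤
        b j K * ∑ x ∈ classSet₁₃ θ K₀ g₀ K, weightB₁₃ θ hP K₀ g₀ os K t x) :
    (crOfRecord₁₃VAt K₀ jcut sh F θ hP g₀ os).W K ≤ ∑ j ∈ Finset.range (jcut K), max (a j K) (b j K) := by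
  refine wInf_le_of_mem ⟨Finset.sum_nonneg fun j hj => (ha j (Finset.mem_range.1 hj)).trans (le_max_left _ _), fun t ht => ⟨?_, ?_⟩⟩
  · rw [sum_badClass₁₃_eq_sum_strata θ K₀ g₀ jcut K t, Finset.sum_mul]
    exact Finset.sum_le_sum fun j hj => (hA t ht j (Finset.mem_range.1 hj)).trans
      (mul_le_mul_of_nonneg_right (le_max_left _ _) (Finset.sum_nonneg fun x _ => weightA₁₃_nonneg F θ hP K₀ g₀ os K t x))
  · rw [sum_badClass₁₃_eq_sum_strata θ K₀ g₀ jcut K t, Finset.sum_mul]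
    exact Finset.sum_le_sum fun j hj => (hB t ht j (Finset.mem_range.1 hj)).trans
      (mul_le_mul_of_nonneg_right (le_max_right _ _) (Finset.sum_nonneg fun x _ => weightB₁₃_nonneg F θ hP K₀ g₀ os K t x))

/-- **★★ N20 AT THE READING OF RECORD FROM PER-BIRTH-LEVEL BUDGETS**: per-stratum relative bounds `a j K ≥ 0`, `b j K` at every step (as above) whose level sums are `< 1` at every
step and summable over `K` ⇒ `RelWeightBound` AT `crOfRecord₁₃VAt K₀ jcut sh F θ hP g₀ os` (all six carriers the reading's own, `W` the canonical one; gen 2's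
`relWeightBound_crOfRecord₁₃VAt_iff`).  The hypotheses are NE7b's body keyed on the birth level — NAMED OPEN.
[cite: Balaban1989LargeFieldII, Thm 1 + (0.1) pp.355–356, (1.80) p.384, (1.85)–(1.89) pp.386–387; King1986, (3.10)–(3.11) p.656 (bookkeeping)] -/
theorem relWeightBound_crOfRecord₁₃VAt_of_levelFractions {a b : ℕ → ℕ → ℝ} (ha : ∀ K, ∀ j < jcut K, 0 ≤ a j K)
    (hA : ∀ (K : ℕ) (t : ℝ), |t| ≤ 1 → ∀ j < jcut K,
      ∑ x ∈ badClass₁₃ θ K₀ g₀ (fun _ => j + 1) K t \ badClass₁₃ θ K₀ g₀ (fun _ => j) K t, weightA₁₃ θ hP K₀ g₀ os K t x ≤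
        a j K * ∑ x ∈ classSet₁₃ θ K₀ g₀ K, weightA₁₃ θ hP K₀ g₀ os K t x)
    (hB : ∀ (K : ℕ) (t : ℝ), |t| ≤ 1 → ∀ j < jcut K,
      ∑ x ∈ badClass₁₃ θ K₀ g₀ (fun _ => j + 1) K t \ badClass₁₃ θ K₀ g₀ (fun _ => j) K t, weightB₁₃ θ hP K₀ g₀ os K t x ≤
        b j K * ∑ x ∈ classSet₁₃ θ K₀ g₀ K, weightB₁₃ θ hP K₀ g₀ os K t x)
    (hlt : ∀ K, ∑ j ∈ Finset.range (jcut K), max (a j K) (b j K) < 1) (hsum : Summable fun K => ∑ j ∈ Finset.range (jcut K), max (a j K) (b j K)) :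
    RelWeightBound (crOfRecord₁₃VAt K₀ jcut sh F θ hP g₀ os).l₀ (crOfRecord₁₃VAt K₀ jcut sh F θ hP g₀ os).T (crOfRecord₁₃VAt K₀ jcut sh F θ hP g₀ os).A
      (crOfRecord₁₃VAt K₀ jcut sh F θ hP g₀ os).B (crOfRecord₁₃VAt K₀ jcut sh F θ hP g₀ os).Bad (crOfRecord₁₃VAt K₀ jcut sh F θ hP g₀ os).W := by
  have hle : ∀ K, (crOfRecord₁₃VAt K₀ jcut sh F θ hP g₀ os).W K ≤ ∑ j ∈ Finset.range (jcut K), max (a j K) (b j K) := fun K =>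
    W_crOfRecord₁₃VAt_le_sum_levels θ hP K₀ g₀ os jcut sh K (ha K) (hA K) (hB K)
  exact (relWeightBound_crOfRecord₁₃VAt_iff θ hP K₀ g₀ os jcut sh).2
    ⟨fun K => (hle K).trans_lt (hlt K), Summable.of_nonneg_of_le (fun K => wInf_nonneg K) hle hsum⟩

end Reading

/-! ## §4  Print's survival shape: a region first created at level `j+1` of the `K₀+K`-level run costs `r` per survived level -/

section Survival

variable {F : T4Family} {N : ℕ} [NeZero N] (θ : Stage13HParams F N) (hP : θ.Provisos₁₃CoPH F N) (K₀ : ℕ) (g₀ : ℕ → ℝ) (os : List (ULoop F))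
  (jcut : ℕ → ℕ) (sh : ShellSplit₁₃CoPH N K₀) [DecidableEq (Σ K, SiteSeqKey F (K₀ + K))]

/-- **★★ THE PERSISTENT-ACTIVITY FRACTION OF RECORD UNDER A PER-BIRTH-LEVEL SURVIVAL RATE**: if at step `K` the cut lies inside the window (`jcut K ≤ K₀ + K`) and, for every
source `|t| ≤ 1` and level `j < jcut K`, the stratum-`j` mass of each run is `≤ V·r^{K₀+K−(j+1)} ·` (that run's class total) — survival factor `r ∈ [0,1[` per level survived since
the birth level `j+1`, entropy letter `V ≥ 0` — then `W K ≤ V·r^{K₀+K−jcut K}∕(1−r)`: GEOMETRIC IN THE AGE FLOOR of the policy.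
[cite: Balaban1989LargeFieldII, (1.80) p.384, (1.89) p.387; Balaban1989LargeFieldI, p.177 (i)–(ii); King1986, (3.10)–(3.11) p.656 (bookkeeping)] -/
theorem W_crOfRecord₁₃VAt_le_survival {r V : ℝ} (h0 : 0 ≤ r) (h1 : r < 1) (hV : 0 ≤ V) (K : ℕ) (hwin : jcut K ≤ K₀ + K)
    (hA : ∀ t : ℝ, |t| ≤ 1 → ∀ j < jcut K,
      ∑ x ∈ badClass₁₃ θ K₀ g₀ (fun _ => j + 1) K t \ badClass₁₃ θ K₀ g₀ (fun _ => j) K t, weightA₁₃ θ hP K₀ g₀ os K t x ≤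
        V * r ^ (K₀ + K - (j + 1)) * ∑ x ∈ classSet₁₃ θ K₀ g₀ K, weightA₁₃ θ hP K₀ g₀ os K t x)
    (hB : ∀ t : ℝ, |t| ≤ 1 → ∀ j < jcut K,
      ∑ x ∈ badClass₁₃ θ K₀ g₀ (fun _ => j + 1) K t \ badClass₁₃ θ K₀ g₀ (fun _ => j) K t, weightB₁₃ θ hP K₀ g₀ os K t x ≤
        V * r ^ (K₀ + K - (j + 1)) * ∑ x ∈ classSet₁₃ θ K₀ g₀ K, weightB₁₃ θ hP K₀ g₀ os K t x) :
    (crOfRecord₁₃VAt K₀ jcut sh F θ hP g₀ os).W K ≤ V * r ^ (K₀ + K - jcut K) / (1 - r) := by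
  have hnn : ∀ j < jcut K, 0 ≤ V * r ^ (K₀ + K - (j + 1)) := fun j _ => mul_nonneg hV (pow_nonneg h0 _)
  refine (W_crOfRecord₁₃VAt_le_sum_levels θ hP K₀ g₀ os jcut sh (a := fun j K => V * r ^ (K₀ + K - (j + 1))) (b := fun j K => V * r ^ (K₀ + K - (j + 1))) K
    hnn hA hB).trans ?_
  simp only [max_self]
  rw [← Finset.mul_sum, mul_div_assoc]
  exact mul_le_mul_of_nonneg_left (sum_range_pow_age_le h0 h1 hwin) hV

/-- **★★ N20 AT THE READING OF RECORD FROM A PER-BIRTH-LEVEL SURVIVAL RATE**: the survival domination at every step (cut inside the window), the age-floor majorant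
`V·r^{K₀+K−jcut K}∕(1−r) < 1` at every step and `Σ_K V·r^{K₀+K−jcut K} < ∞` ⇒ `RelWeightBound` AT `crOfRecord₁₃VAt K₀ jcut sh F θ hP g₀ os` with its canonical `W`.  The survival
domination is NE7b's body in the renewal currency — a HYPOTHESIS, NAMED OPEN (NOT PRINTED for `d = 4`, NOT proved).
[cite: Balaban1989LargeFieldII, Thm 1 + (0.1) pp.355–356, (1.80) p.384, (1.89) p.387; King1986, (3.10)–(3.11) p.656 (bookkeeping)] -/
theorem relWeightBound_crOfRecord₁₃VAt_of_survival {r V : ℝ} (h0 : 0 ≤ r) (h1 : r < 1) (hV : 0 ≤ V) (hwin : ∀ K, jcut K ≤ K₀ + K)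
    (hA : ∀ (K : ℕ) (t : ℝ), |t| ≤ 1 → ∀ j < jcut K,
      ∑ x ∈ badClass₁₃ θ K₀ g₀ (fun _ => j + 1) K t \ badClass₁₃ θ K₀ g₀ (fun _ => j) K t, weightA₁₃ θ hP K₀ g₀ os K t x ≤
        V * r ^ (K₀ + K - (j + 1)) * ∑ x ∈ classSet₁₃ θ K₀ g₀ K, weightA₁₃ θ hP K₀ g₀ os K t x)
    (hB : ∀ (K : ℕ) (t : ℝ), |t| ≤ 1 → ∀ j < jcut K,
      ∑ x ∈ badClass₁₃ θ K₀ g₀ (fun _ => j + 1) K t \ badClass₁₃ θ K₀ g₀ (fun _ => j) K t, weightB₁₃ θ hP K₀ g₀ os K t x ≤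
        V * r ^ (K₀ + K - (j + 1)) * ∑ x ∈ classSet₁₃ θ K₀ g₀ K, weightB₁₃ θ hP K₀ g₀ os K t x)
    (hlt : ∀ K, V * r ^ (K₀ + K - jcut K) / (1 - r) < 1) (hsum : Summable fun K => V * r ^ (K₀ + K - jcut K)) :
    RelWeightBound (crOfRecord₁₃VAt K₀ jcut sh F θ hP g₀ os).l₀ (crOfRecord₁₃VAt K₀ jcut sh F θ hP g₀ os).T (crOfRecord₁₃VAt K₀ jcut sh F θ hP g₀ os).A
      (crOfRecord₁₃VAt K₀ jcut sh F θ hP g₀ os).B (crOfRecord₁₃VAt K₀ jcut sh F θ hP g₀ os).Bad (crOfRecord₁₃VAt K₀ jcut sh F θ hP g₀ os).W := by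
  have hle : ∀ K, (crOfRecord₁₃VAt K₀ jcut sh F θ hP g₀ os).W K ≤ V * r ^ (K₀ + K - jcut K) / (1 - r) := fun K =>
    W_crOfRecord₁₃VAt_le_survival θ hP K₀ g₀ os jcut sh h0 h1 hV K (hwin K) (hA K) (hB K)
  exact (relWeightBound_crOfRecord₁₃VAt_iff θ hP K₀ g₀ os jcut sh).2
    ⟨fun K => (hle K).trans_lt (hlt K), Summable.of_nonneg_of_le (fun K => wInf_nonneg K) hle (hsum.div_const (1 - r))⟩

/-- **N20 AT THE READING OF RECORD FROM A SURVIVAL RATE AND A LINEAR AGE FLOOR**: as above, with the summability supplied by `c·K ≤ K₀ + K − jcut K` (`c > 0`, `0 < r`) — e.g.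
print's window policy `jcut K = K₀ + K − j⋆(K)` with `j⋆(K) ≥ c·K` recent levels uncut.
[cite: Balaban1989LargeFieldII, Thm 1 + (0.1) pp.355–356, (1.80) p.384, (1.89) p.387; King1986, (3.10)–(3.11) p.656 (bookkeeping)] -/
theorem relWeightBound_crOfRecord₁₃VAt_of_survival_linearAge {r V c : ℝ} (h0 : 0 < r) (h1 : r < 1) (hV : 0 ≤ V) (hc : 0 < c)
    (hwin : ∀ K, jcut K ≤ K₀ + K) (hfrac : ∀ K : ℕ, c * K ≤ ((K₀ + K - jcut K : ℕ) : ℝ))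
    (hA : ∀ (K : ℕ) (t : ℝ), |t| ≤ 1 → ∀ j < jcut K,
      ∑ x ∈ badClass₁₃ θ K₀ g₀ (fun _ => j + 1) K t \ badClass₁₃ θ K₀ g₀ (fun _ => j) K t, weightA₁₃ θ hP K₀ g₀ os K t x ≤
        V * r ^ (K₀ + K - (j + 1)) * ∑ x ∈ classSet₁₃ θ K₀ g₀ K, weightA₁₃ θ hP K₀ g₀ os K t x)
    (hB : ∀ (K : ℕ) (t : ℝ), |t| ≤ 1 → ∀ j < jcut K,
      ∑ x ∈ badClass₁₃ θ K₀ g₀ (fun _ => j + 1) K t \ badClass₁₃ θ K₀ g₀ (fun _ => j) K t, weightB₁₃ θ hP K₀ g₀ os K t x ≤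
        V * r ^ (K₀ + K - (j + 1)) * ∑ x ∈ classSet₁₃ θ K₀ g₀ K, weightB₁₃ θ hP K₀ g₀ os K t x)
    (hlt : ∀ K, V * r ^ (K₀ + K - jcut K) / (1 - r) < 1) :
    RelWeightBound (crOfRecord₁₃VAt K₀ jcut sh F θ hP g₀ os).l₀ (crOfRecord₁₃VAt K₀ jcut sh F θ hP g₀ os).T (crOfRecord₁₃VAt K₀ jcut sh F θ hP g₀ os).A
      (crOfRecord₁₃VAt K₀ jcut sh F θ hP g₀ os).B (crOfRecord₁₃VAt K₀ jcut sh F θ hP g₀ os).Bad (crOfRecord₁₃VAt K₀ jcut sh F θ hP g₀ os).W :=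
  relWeightBound_crOfRecord₁₃VAt_of_survival θ hP K₀ g₀ os jcut sh h0.le h1 hV hwin hA hB hlt (summable_ageMajorant_of_linearAge h0 h1 hV hc hfrac)

end Survival

/-! ## §5  The K3⁷ v5 binder shape (`N = 2`, `K₀ = 0`, per-tuple cut reading `jc`): `KeyedRelWeight` at the pinned V reading from per-tuple survival data -/

section Shape

/-- **★★ THE K3⁷ v5 `KeyedRelWeight` BODY AT THE PER-TUPLE-CUT V READING OF RECORD `fun F θ hP g₀ os ↦ crOfRecord₁₃VAt 0 (jc F θ hP g₀ os) sh F θ hP g₀ os` FROM PER-TUPLE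
SURVIVAL DATA**: at every guarded admissible Stage-13 tuple with core provisos (`N = 2`) and every `g₀`, `os`, a survival rate `r < 1`, an entropy letter `V`, the cut inside the
window, the per-birth-level survival domination of both runs' strata, the age-floor majorant `< 1` and summable ⇒ the `KeyedRelWeight` conjunct of `stub_expansion13H` at that
reading (spelled out; the skeleton's `def` is not the tree's).  The guards are not used.  The survival data are NE7b's body — NAMED OPEN.
[cite: Balaban1989LargeFieldII, Thm 1 + (0.1) pp.355–356, (1.80) p.384, (1.89) p.387; King1986, (3.10)–(3.11) p.656 (bookkeeping)] -/
theorem keyedRelWeight_shape_crOfRecord₁₃V_of_survival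
    (jc : (F : T4Family) → (θ : Stage13HParams F 2) → θ.Provisos₁₃CoPH F 2 → (ℕ → ℝ) → List (ULoop F) → ℕ → ℕ) (sh : ShellSplit₁₃CoPH 2 0)
    (hsurv : ∀ (F : T4Family) (θ : Stage13HParams F 2) (hP : θ.Provisos₁₃CoPH F 2), (θ.ZhUnity F 2 ∧ θ.SlotsNondegenerate₁₃ F 2) → θ.Admissible F 2 →
      ∀ (g₀ : ℕ → ℝ) (os : List (ULoop F)), letI := Classical.decEq (Σ K, SiteSeqKey F (0 + K))
      ∃ r V : ℝ, 0 ≤ r ∧ r < 1 ∧ 0 ≤ V ∧ (∀ K, jc F θ hP g₀ os K ≤ 0 + K) ∧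
        (∀ (K : ℕ) (t : ℝ), |t| ≤ 1 → ∀ j < jc F θ hP g₀ os K,
          ∑ x ∈ badClass₁₃ θ 0 g₀ (fun _ => j + 1) K t \ badClass₁₃ θ 0 g₀ (fun _ => j) K t, weightA₁₃ θ hP 0 g₀ os K t x ≤
            V * r ^ (0 + K - (j + 1)) * ∑ x ∈ classSet₁₃ θ 0 g₀ K, weightA₁₃ θ hP 0 g₀ os K t x) ∧
        (∀ (K : ℕ) (t : ℝ), |t| ≤ 1 → ∀ j < jc F θ hP g₀ os K,
          ∑ x ∈ badClass₁₃ θ 0 g₀ (fun _ => j + 1) K t \ badClass₁₃ θ 0 g₀ (fun _ => j) K t, weightB₁₃ θ hP 0 g₀ os K t x ≤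
            V * r ^ (0 + K - (j + 1)) * ∑ x ∈ classSet₁₃ θ 0 g₀ K, weightB₁₃ θ hP 0 g₀ os K t x) ∧
        (∀ K, V * r ^ (0 + K - jc F θ hP g₀ os K) / (1 - r) < 1) ∧ Summable fun K => V * r ^ (0 + K - jc F θ hP g₀ os K)) :
    ∀ (F : T4Family) (θ : Stage13HParams F 2) (hP : θ.Provisos₁₃CoPH F 2), (θ.ZhUnity F 2 ∧ θ.SlotsNondegenerate₁₃ F 2) → θ.Admissible F 2 →
      ∀ (g₀ : ℕ → ℝ) (os : List (ULoop F)),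
        RelWeightBound (crOfRecord₁₃VAt 0 (jc F θ hP g₀ os) sh F θ hP g₀ os).l₀ (crOfRecord₁₃VAt 0 (jc F θ hP g₀ os) sh F θ hP g₀ os).T
          (crOfRecord₁₃VAt 0 (jc F θ hP g₀ os) sh F θ hP g₀ os).A (crOfRecord₁₃VAt 0 (jc F θ hP g₀ os) sh F θ hP g₀ os).B
          (crOfRecord₁₃VAt 0 (jc F θ hP g₀ os) sh F θ hP g₀ os).Bad (crOfRecord₁₃VAt 0 (jc F θ hP g₀ os) sh F θ hP g₀ os).W := by
  intro F θ hP hG hθ g₀ os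
  letI := Classical.decEq (Σ K, SiteSeqKey F (0 + K))
  obtain ⟨r, V, h0, h1, hV, hwin, hA, hB, hlt, hsum⟩ := hsurv F θ hP hG hθ g₀ os
  exact relWeightBound_crOfRecord₁₃VAt_of_survival θ hP 0 g₀ os (jc F θ hP g₀ os) sh h0 h1 hV hwin hA hB hlt hsum

end Shape

end Summit.QuantumFields.YangMills.BalabanUVNodes.N20KeyedRelWeightLevels

end
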